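import Literature.AlgebraicGeometry.Motives.GenericProjectionCone
import Literature.AlgebraicGeometry.Motives.FiniteMorphismCodimension
import Literature.AlgebraicGeometry.Motives.VarietiesProjectiveSpaceProofs
import Literature.AlgebraicGeometry.HodgeTheory.MovingLemmaExcessInduction
import Literature.AlgebraicGeometry.HodgeTheory.AmbientClassesMoving
import Literature.AlgebraicGeometry.HodgeTheory.MotivatedClassesAssembly
import Summits.HodgeConjecture.HodgeConjecture.Theorems.PadicSemiregularLiftHodgeBeyondAnchorsConeTransport
import Summits.HodgeConjecture.HodgeConjecture.Theorems.PadicSemiregularLiftHodgeBeyondAnchorsLocalHomeomorphOfSmooth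
import Summits.HodgeConjecture.HodgeConjecture.Theorems.PadicSemiregularLiftHodgeBeyondAnchorsSupportedClassNeZero
import HarnessLib

/-!
# Route HeckePrymWeil — `SummitOffWeilSector` (stmt-HodgeConjecture-14374), line `motivated-anchor-split`: the multiplicativity of algebraic classes (Voisin II Prop. 9.20, ALL bidegrees) from Roberts' generic projection cone alone

Wave 1 of lead c2 returned `stub-blocked` for Stub 4b `stub_cupProductAlgebraicHigher` (the
bidegrees `2 ≤ a`, `2 ≤ b`, `a + b + 2 ≤ d` of `Nᵃ ∪ Nᵇ ⊆ Nᵃ⁺ᵇ`), naming ONE existing Literature named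
fact: `Literature.AlgebraicGeometry.Motives.Roberts1972_genericProjection` (J. Roberts, *Chow's moving
lemma* (1972), Main Lemma; W. Fulton, *Intersection Theory* §11.4 Ex. 11.4.1 (a)–(b): the generic
projection cone `π_L^*[C_L] = [V] + γ_L` with Roberts' excess count). This file kernel-checks that
reduction: granted `Roberts1972_genericProjection`, the CONE STEP `hstep` of the tree's excess
induction (`HodgeTheory/MovingLemmaExcessInduction`, everything else proved there) holds on every
smooth projective complex variety (`coneStep_of_roberts1972` — the glue of the twin crux line
`Cruxes/HodgeBeyondAnchors/Lines/andre_motivated_split.lean`, fed with the LANDED theorems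
`stub_localHomeomorph_of_smooth` (SGA1 XII 3.1 (iii) on an open), `stub_coneTransport` (transport of
the Thom line along the finite projection at one good complex point) and `stub_supportedClass_ne_zero`
(an irreducible subvariety of `ℙⁿ` supports a non-zero class) of
`Theorems/PadicSemiregularLiftHodgeBeyondAnchors{LocalHomeomorphOfSmooth,ConeTransport,SupportedClassNeZero}`),
hence `Voisin2003_cupProduct_algebraicClasses` in ALL bidegrees (`voisin2003_of_roberts1972`, by
`cupProduct_mem_algebraicClasses_of_coneStep`) and in particular Stub 4b
(`stub_cupProductAlgebraicHigher_of_roberts1972`, registered sub-goal). So the line's multiplicativity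
debt is exactly the one named fact `Roberts1972_genericProjection` — shared verbatim with the twin
line's `stub_genericProjection` (crux stmt-HodgeConjecture-14054) and with the support item
stmt-HodgeConjecture-17490 of route `MotivatedLefschetzSplit`.

No definition and no named fact is introduced; `Roberts1972_genericProjection` enters as an explicit
hypothesis only.

## References

* [Roberts1972] J. Roberts, Chow's moving lemma, in: Algebraic Geometry (Oslo 1970), Wolters-Noordhoff
  1972, 89–96: Main Lemma, §2, Lemma 3.
* [Fulton1998] W. Fulton, Intersection Theory, 2nd ed., Springer 1998, §11.4 Example 11.4.1 (a)–(b),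
  §19.1–19.2.
* [VoisinHodgeII2003] C. Voisin, Hodge Theory and Complex Algebraic Geometry II, CUP 2003, §9.2.4
  Prop. 9.20, Lemma 9.22.
* [SGA1] A. Grothendieck, SGA 1, Exposé XII Prop. 3.1 (iii).
-/

noncomputable section

-- every declaration of this problem lives in `Summit.HodgeConjecture.HodgeConjecture.…` (summit = sub-problem)
set_option linter.dupNamespace false

open CategoryTheory AlgebraicGeometry Order Set
open Literature.AlgebraicGeometry.Motives Literature.AlgebraicGeometry.HodgeTheory
  Literature.AlgebraicTopology.SingularHomology
open Summit.HodgeConjecture.HodgeConjecture.Theorems.HodgeBeyondAnchors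

namespace Summit.HodgeConjecture.HodgeConjecture.Theorems

/-- **A good complex point of an irreducible subvariety for a morphism smooth on an open set meeting
it**: for `φ : X ⟶ Y` between smooth projective `n`-folds, `Z ⊆ X` closed irreducible and `U ⊆ X`
open meeting `Z` with `φ|_U` smooth, some complex point `P` of `Z` has a neighbourhood on which
`φ(ℂ)` is a local homeomorphism (`Z(ℂ) ∩ U(ℂ) ≠ ∅` since `Z ∩ U` is a non-empty open subset of the
irreducible `Z`, `ComplexPoints.isConnected_setOf_pt_mem_inter_of_isIrreducible`; SGA1 XII 3.1 (iii)
in the landed form `stub_localHomeomorph_of_smooth`). [cite: SGA1, Exposé XII Prop. 3.1 (iii)] -/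
theorem exists_goodPoint_of_smooth {n : ℕ} {X Y : SchemeOver ℂ} (hX : IsSmoothProjective n X)
    (hY : IsSmoothProjective n Y) (φ : X ⟶ Y) {Z : Set X.left} (hZ : IsClosed Z)
    (hZi : IsIrreducible Z) {U : X.left.Opens} (hZU : ∃ z ∈ Z, z ∈ U)
    (hU : Smooth (U.ι ≫ φ.left)) :
    ∃ P : ComplexPoints X, P.pt ∈ Z ∧
      ∃ e : OpenPartialHomeomorph (ComplexPoints X) (ComplexPoints Y),
        P ∈ e.source ∧ Set.EqOn (AlgPoints.map φ) e e.source := by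
  haveI := hX.smoothOfRelativeDimension
  haveI : LocallyOfFiniteType X.hom := by
    haveI : Smooth X.hom := SmoothOfRelativeDimension.smooth n _
    infer_instance
  obtain ⟨z, hz, hzU⟩ := hZU
  obtain ⟨P, hPZ, hPU⟩ :=
    (ComplexPoints.isConnected_setOf_pt_mem_inter_of_isIrreducible X hZ hZi U ⟨z, hz, hzU⟩).nonempty
  exact ⟨P, hPZ, stub_localHomeomorph_of_smooth hX hY φ U hU P hPU⟩

/-- **The cone step of Chow's moving lemma on the coniveau carrier, from Roberts' generic projection
cone.** Granted `Roberts1972_genericProjection` (Fulton Ex. 11.4.1 (a)–(b) / Roberts' Main Lemma: for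
`Z` meeting `W` improperly, a finite `φ : X ⟶ ℙⁿ`, étale on an open set meeting `Z`, and a residual
closed `Z' ⊉ Z` of codimension `≥ l` with `φ⁻¹(φ Z) ⊆ Z ∪ Z'` and `codim (Z' ∩ W) > codim (Z ∩ W)`),
the hypothesis `hstep` of `cupProduct_mem_algebraicClasses_of_coneStep` holds on every smooth
projective complex `n`-fold `X`: a class dying off `Z` is the transported Thom line
`ℂ · φ^* b` (`stub_coneTransport` at a good complex point, `exists_goodPoint_of_smooth`; `b` a non-zero
class supported on the irreducible `φ(Z) ⊆ ℙⁿ`, `stub_supportedClass_ne_zero`, which moves in `ℙⁿ`,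
`map_projectiveSpace_mem_iSup_ker_restrictCompl`) plus a class dying off `Z'`. Degenerate cases: `Z`
already proper (nothing to do) and `Z` of codimension `> l` everywhere (no class dies off it,
semipurity `injective_restrictCompl_of_le_coheight`). Glue adapted from the twin line
`Cruxes/HodgeBeyondAnchors/Lines/andre_motivated_split.lean` (`coneStep`).
[cite: Fulton1998, §11.4 Example 11.4.1 (a)–(b)] [cite: Roberts1972, Main Lemma and §2]
[cite: VoisinHodgeII2003, §9.2.4 Lemma 9.22] -/
theorem coneStep_of_roberts1972 (hR : Roberts1972_genericProjection) {n : ℕ} {X : SchemeOver ℂ}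
    (hX : IsSmoothProjective n X) {l k : ℕ} :
    ∀ ⦃Z W : Set X.left⦄, IsClosed Z → IsIrreducible Z →
      (∀ z ∈ Z, (l : ℕ∞) ≤ Order.coheight z) → IsClosed W → IsIrreducible W →
      (∀ w ∈ W, (k : ℕ∞) ≤ Order.coheight w) → ∀ s : ℕ, s < l + k →
      (∀ t ∈ Z ∩ W, (s : ℕ∞) ≤ Order.coheight t) →
        LinearMap.ker (complexBetti.restrictCompl X Z (2 * l)).hom ≤
          (⨆ (T : Set X.left) (_ : IsClosed T)
            (_ : ∀ t ∈ T ∩ W, ((l + k : ℕ) : ℕ∞) ≤ Order.coheight t),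
            LinearMap.ker (complexBetti.restrictCompl X T (2 * l)).hom) ⊔
          ⨆ (Z' : Set X.left) (_ : IsClosed Z') (_ : ∀ z ∈ Z', (l : ℕ∞) ≤ Order.coheight z)
            (_ : ∀ t ∈ Z' ∩ W, ((s + 1 : ℕ) : ℕ∞) ≤ Order.coheight t),
            LinearMap.ker (complexBetti.restrictCompl X Z' (2 * l)).hom := by
  intro Z W hZ hZi hZl hW hWi hWk s hs hZW
  by_cases hprop : ∀ t ∈ Z ∩ W, ((l + k : ℕ) : ℕ∞) ≤ coheight t
  · exact le_sup_of_le_left (le_iSup_of_le Z (le_iSup_of_le hZ (le_iSup_of_le hprop le_rfl)))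
  have himp : ∃ t ∈ Z ∩ W, coheight t < ((l + k : ℕ) : ℕ∞) := by
    push Not at hprop
    obtain ⟨t, ht, hlt⟩ := hprop
    exact ⟨t, ht, hlt⟩
  have hl : 1 ≤ l := by
    obtain ⟨t, ht, hlt⟩ := himp
    by_contra h0
    have hl0 : l = 0 := by omega
    subst hl0
    have hk := hWk t ht.2
    rw [Nat.zero_add] at hlt
    exact absurd (lt_of_le_of_lt hk hlt) (lt_irrefl _)
  by_cases hpt : ∃ z ∈ Z, coheight z ≤ (l : ℕ∞)
  swap
  · have h' : ∀ z ∈ Z, ((l + 1 : ℕ) : ℕ∞) ≤ coheight z := by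
      intro z hz
      push Not at hpt
      have hlt := hpt z hz
      push_cast
      exact Order.add_one_le_of_lt hlt
    intro x hx
    have hinj := injective_restrictCompl_of_le_coheight hX hZ h' (i := 2 * l) (by omega)
    have h0 : x = 0 := hinj (by rw [LinearMap.mem_ker.1 hx, map_zero])
    rw [h0]
    exact Submodule.zero_mem _
  obtain ⟨φ, hφ, Z', hZ'c, -, hZ'l, hpre, hZ'W, U, hZU, hU⟩ :=
    hR hX hl hZ hZi hZl hpt hW hWi hWk himp
  haveI := hφ
  have hZ'W' : ∀ t ∈ Z' ∩ W, ((s + 1 : ℕ) : ℕ∞) ≤ coheight t := by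
    intro t' ht'
    obtain ⟨t, ht, hlt⟩ := hZ'W t' ht'
    have hst : (s : ℕ∞) < coheight t' := lt_of_le_of_lt (hZW t ht) hlt
    push_cast
    exact Order.add_one_le_of_lt hst
  have hP : IsSmoothProjective n (projectiveSpace n ℂ) := isSmoothProjective_projectiveSpace_holds ℂ n
  obtain ⟨hCc, hCi, hCl, hCl'⟩ := image_codim_of_isFinite hX hP φ hZ hZi hZl hpt
  obtain ⟨b, hb, hb0⟩ := stub_supportedClass_ne_zero hP hCc hCi hl hCl hCl'
  have hloc := exists_goodPoint_of_smooth hX hP φ hZ hZi hZU hU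
  have hΘ := stub_coneTransport hX hP φ hl hZ hZi hZl hZ'c hpre hloc hb hb0
  refine hΘ.trans (sup_le (le_sup_of_le_left ?_) (le_sup_of_le_right ?_))
  · rw [Submodule.span_le, Set.singleton_subset_iff]
    exact map_projectiveSpace_mem_iSup_ker_restrictCompl hX φ hW hWk b
  · exact le_iSup_of_le Z' (le_iSup_of_le hZ'c (le_iSup_of_le hZ'l (le_iSup_of_le hZ'W' le_rfl)))

/-- **Voisin II Prop. 9.20 on the coniveau carrier, in ALL bidegrees, from Roberts' generic projection
cone**: granted `Roberts1972_genericProjection`, `Nᵃ H²ᵃ ∪ Nᵇ H²ᵇ ⊆ Nᵃ⁺ᵇ H^{2(a+b)}` on every smooth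
projective complex variety (`Voisin2003_cupProduct_algebraicClasses`), by the tree's excess induction
`cupProduct_mem_algebraicClasses_of_coneStep` fed with `coneStep_of_roberts1972`.
[cite: VoisinHodgeII2003, §9.2.4 Prop. 9.20 and Lemma 9.22] [cite: Fulton1998, §11.4 Example 11.4.1 (a)–(b)] -/
theorem voisin2003_of_roberts1972 (hR : Roberts1972_genericProjection) :
    Voisin2003_cupProduct_algebraicClasses :=
  fun _ _ hV _ _ _ _ hx hy ↦
    cupProduct_mem_algebraicClasses_of_coneStep hV (coneStep_of_roberts1972 hR hV) hx hy

/-- **Registered sub-goal `stub_cupProductAlgebraicHigher_of_roberts1972` of stmt-HodgeConjecture-14374**: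
the line's Stub 4b (the higher bidegrees `2 ≤ a`, `2 ≤ b`, `a + b + 2 ≤ d` of the multiplicativity)
from the one named fact `Roberts1972_genericProjection` (specialisation of
`voisin2003_of_roberts1972`). [cite: VoisinHodgeII2003, §9.2.4 Prop. 9.20] [cite: Roberts1972, Main Lemma] -/
theorem stub_cupProductAlgebraicHigher_of_roberts1972 :
    Roberts1972_genericProjection →
    ∀ ⦃d : ℕ⦄ ⦃V : SchemeOver ℂ⦄, IsSmoothProjective d V → ∀ ⦃a b : ℕ⦄, 2 ≤ a → 2 ≤ b →
      a + b + 2 ≤ d → ∀ ⦃x : complexBetti V (2 * a)⦄ ⦃y : complexBetti V (2 * b)⦄,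
        x ∈ algebraicClasses V a → y ∈ algebraicClasses V b →
          cupProduct (two_mul_add_two_mul a b) x y ∈ algebraicClasses V (a + b) :=
  fun hR _ _ hV _ _ _ _ _ _ _ hx hy ↦ voisin2003_of_roberts1972 hR hV hx hy

end Summit.HodgeConjecture.HodgeConjecture.Theorems

end
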